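import Summits.HodgeConjecture.CorCM.CMAlgebraDegreeLeEightFamilies
import Summits.HodgeConjecture.CorCM.CMAbelianVarietyDimLeThreePowers
import Summits.HodgeConjecture.CorCM.CMProductSimpleFactors
import Literature.AlgebraicGeometry.Motives.AbelianVarietyEndAlgebraIsogenyInvariance
import Literature.AlgebraicGeometry.Milne1999.CMTypeNonzeroHom
import Summits.HodgeConjecture.HodgeConjecture.Theorems.Ring2AtlasUnitaryThreefoldPairNonVacuity
import HarnessLib

/-!
# Complex abelian FOURFOLDS of CM type: `B•(X) = D•(X)` iff all powers are divisor-generated iff `X` is neither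
# `E × T` with `End⁰(E) ↪ End⁰(T)` nor simple degenerate — Moonen–Zarhin (0.1), CM case, on the variety

COR-CM (cell `pub-hodgecm2`, binder seat `b16` gen 38, count-neutral claim CM4-CLASSIF, file 2 of 3; theorems only,
no definition, no named fact).  NEW as stated (an assembly of tree theorems), hence under `Summits/`.

[MoonenZarhin1999LowDim, Thm. (0.1)]: «Let `X` be a complex abelian variety with `dim X ≤ 4`. … (a) `X` is
isogenous to a product `X₁ × X₂` where `X₁` is an elliptic curve with complex multiplication by an imaginary quadratic
field `k` and where `X₂` is a simple abelian threefold such that there exists an embedding `k ↪ End⁰(X₂)`; (b) `X` is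
simple of dimension `4` such that `End⁰(X)` is a field containing an imaginary quadratic field `k` which acts on
`T_{X,0}` with multiplicities `(2,2)` … (4) Suppose we are not in one of the cases (a), (b), (c) or (d). Then …
`B•(Xⁿ) = D•(Xⁿ)` for all `n`. … in the cases (a), (b) … `D²(X) ≠ B²(X)`.»  ((c), (d) are not of CM type.)  This file
is the CM case ON THE VARIETY — the dimension-`4` sequel of seat b16 gen 36's `CorCM/CMAbelianVarietyDimLeThreePowers`
(dimension `≤ 3`: all powers divisor-generated) and the non-simple twin of lit-deligne-3's
`Pohlmann1968/SimpleCMAbelianFourfoldPowers` (simple CM fourfolds): for a complex abelian variety `X` of CM type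
(`Milne1999.IsOfCMType`) with `dim X = 4`, Milne's regrouping `X ∼ ⨁ᵢ A'_{cls i}` into simple, pairwise non-isogenous CM
representatives (gen 36) has total dimension `4`, so the type-level criterion of file 1
(`CorCM/CMAlgebraDegreeLeEightFamilies`) applies, and Moonen–Zarhin's case (a) is read off the ISOGENY FACTORS of `X`
(`Domination.AVDominatedBy`, Mumford §19; uniqueness of the simple factors: a simple isogeny factor of `⨁ᵢ A'_{cls i}` is
isogenous to some `A'_{cls i}`):

* §1 isogeny factors: `avDominatedBy_biproduct_summand`, `avDominatedBy_prod_right`, `ne_zero_of_comp_eq_nsmul_id`,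
  **`exists_isIsogenous_of_isSimple_of_avDominatedBy_biproduct`** (a simple isogeny factor of a product of simple
  abelian varieties is isogenous to one of them), `isIsogenous_of_isSimple_of_avDominatedBy`; (§2 — `End⁰(A) ≅ K`
  for a simple realisation of a CM type of `K`, Shimura §5.1 Props. 3–6 — is the tree theorem
  `Ring2.Atlas.nonempty_ringEquiv_endAlgebra_of_isSimple`, imported BY NAME);
* §3 case (a): **`exists_exceptional_two_of_curve_threefold_factors`** — an elliptic curve `E` and a simple threefold
  `T`, both isogeny factors of the CM fourfold `X`, with `End⁰(E) ↪ End⁰(T)`, force a rational `(2,2)`-class on `X`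
  OUTSIDE `D²(X) ⊗ ℂ` («`D²(X) ≠ B²(X)`»); **`exists_exceptional_two_of_isIsogenous_curve_prod_threefold`** — the same
  for `X ∼ E × T` verbatim;
* §4 **`isDivisorGenerated_of_avDominatedBy_powSucc_of_isOfCMType_of_dim_four`** (MASTER FORM) — if the CM fourfold
  `X` is divisor-generated then so is EVERYTHING DOMINATED BY A POWER of `X` (all `X^{N+1}`, everything isogenous to,
  an abelian subvariety of or a quotient of one); **`isDivisorGenerated_iff_forall_powSucc_of_isOfCMType_of_dim_four`**
  — `B•(X) = D•(X) ⟺ B•(X^{N+1}) = D•(X^{N+1})` for all `N`: exceptional classes of CM fourfolds appear on `X` itself,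
  in `H⁴`, or nowhere; the Hodge conjecture for all these varieties (`hodgeConjectureFor_…`), UNCONDITIONALLY;
* §5 (file 3, `CorCM/CMAbelianFourfoldClassification`): the classification `B = D ⟺ ¬(a) ∧ ¬(b)` and the dichotomy.

## References

* [MoonenZarhin1999LowDim] B. Moonen, Yu. Zarhin, *Hodge classes on abelian varieties of low dimension*, Math. Ann.
  315 (1999) 711–733, Thm. (0.1) (a), (b), (1), (4) and the remark after it; §5 (5.1)–(5.2).
* [MumfordAV1970] D. Mumford, *Abelian Varieties*, §19 Thm. 1, Cor. 1–2 (pp. 173–174) and Remark p. 169.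
* [Milne1999LefschetzClasses] J. S. Milne, Duke Math. J. 96 (1999), §1 Prop. 1.1; [Shimura1998] G. Shimura, §5.1
  Props. 3–6, §8.2 Prop. 26.
* [Gordon1999HodgeAVSurvey] B. B. Gordon, *A survey of the Hodge conjecture for abelian varieties*, 5.13, 7.5–7.6, 10.10.
-/

noncomputable section

open CategoryTheory CategoryTheory.Limits NumberField
open scoped BigOperators

namespace Summit.HodgeConjecture.CorCM

open Literature.NumberTheory.ComplexMultiplication
open Literature.AlgebraicGeometry.Motives (AbelianVariety CMType)
open Literature.AlgebraicGeometry.Motives.AbelianVariety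
open Literature.AlgebraicGeometry.HodgeTheory
open Literature.AlgebraicGeometry.ComplexMultiplication
open Literature.AlgebraicGeometry.VanGeemen1994 (hodgeClassSpan)
open Literature.AlgebraicGeometry.Milne1999
open Literature.AlgebraicGeometry.Pohlmann1968
open Literature.Barriers.HodgeConjecture (divisorClassesSpan)
open Summit.HodgeConjecture.CorCM.Domination
open Summit.HodgeConjecture.HodgeConjecture.Ring2.ClassTargets (HCOnClass)
open Summit.HodgeConjecture.HodgeConjecture.Ring2.Atlas (nonempty_ringEquiv_endAlgebra_of_isSimple)

/-! ## §1 Isogeny factors: summands, products, and uniqueness of the simple factors -/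

section Factors

/-- A summand of a biproduct is an isogeny factor of it: `F j ≼ ⨁ F` (`ι_j ≫ π_j = 𝟙`). [cite: MumfordAV1970, §19] -/
theorem avDominatedBy_biproduct_summand {J : Type} [Fintype J] (F : J → AbelianVariety ℂ) (j : J) :
    AVDominatedBy (F j) (⨁ F) := by
  classical
  exact ⟨biproduct.ι F j, biproduct.π F j, 1, one_ne_zero, by rw [biproduct.ι_π_self, one_smul]⟩

/-- The second factor of a binary product is dominated by it: `C ≼ B × C` (companion of
`SliceExhaustion.avDominatedBy_prod_left`). [cite: MumfordAV1970, §19] -/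
theorem avDominatedBy_prod_right (B C : AbelianVariety ℂ) : AVDominatedBy C (B.prod C) :=
  ⟨AbelianVariety.prodLift 0 (𝟙 C), AbelianVariety.snd B C, 1, one_ne_zero, by
    rw [AbelianVariety.prodLift_snd, one_smul]⟩

/-- **Both homomorphisms of a domination `s ≫ π = [N]_A`, `N ≠ 0`, of a POSITIVE-dimensional `A` are non-zero**
(`[N]_A ≠ 0`: `Hom` is torsion-free and `𝟙_A ≠ 0`). [cite: MumfordAV1970, §19 Thm. 3 and Remark p. 169] -/
theorem ne_zero_of_comp_eq_nsmul_id {A P : AbelianVariety ℂ} {s : A ⟶ P} {π : P ⟶ A} {N : ℕ} (hN : N ≠ 0)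
    (hsπ : s ≫ π = N • 𝟙 A) (h0 : 0 < A.dim) : s ≠ 0 ∧ π ≠ 0 := by
  refine ⟨fun hs => ?_, fun hπ => ?_⟩
  · rw [hs, zero_comp] at hsπ
    exact id_ne_zero_of_dim_pos h0 (hom_eq_zero_of_nsmul_eq_zero hN hsπ.symm)
  · rw [hπ, comp_zero] at hsπ
    exact id_ne_zero_of_dim_pos h0 (hom_eq_zero_of_nsmul_eq_zero hN hsπ.symm)

/-- **A simple isogeny factor of a simple abelian variety is isogenous to it** (a non-zero homomorphism between
simple abelian varieties is an isogeny). [cite: MumfordAV1970, §19 Cor. 2 of Thm. 1 (p. 174)] -/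
theorem isIsogenous_of_isSimple_of_avDominatedBy {S P : AbelianVariety ℂ} (hS : S.IsSimple) (hP : P.IsSimple)
    (h0 : 0 < S.dim) (h : AVDominatedBy S P) : IsIsogenous S P := by
  obtain ⟨s, π, N, hN, hsπ⟩ := h
  exact ⟨s, isIsogeny_of_isSimple_of_ne_zero hS hP s (ne_zero_of_comp_eq_nsmul_id hN hsπ h0).1⟩

/-- **Uniqueness of the simple isogeny factors** (Mumford §19 Cor. 1, the part used here): a SIMPLE abelian variety
of positive dimension which is an isogeny factor of a product `⨁_j F_j` of SIMPLE abelian varieties is isogenous to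
some `F_j` (some component `S → F_j` of the section is non-zero, hence an isogeny).
[cite: MumfordAV1970, §19 Thm. 1, Cor. 1–2 (pp. 173–174)] [cite: Milne1999LefschetzClasses, §1 Prop. 1.1] -/
theorem exists_isIsogenous_of_isSimple_of_avDominatedBy_biproduct {J : Type} [Fintype J] {F : J → AbelianVariety ℂ}
    {S : AbelianVariety ℂ} (hF : ∀ j, (F j).IsSimple) (hS : S.IsSimple) (h0 : 0 < S.dim)
    (h : AVDominatedBy S (⨁ F)) : ∃ j, IsIsogenous S (F j) := by
  classical
  obtain ⟨s, π, N, hN, hsπ⟩ := h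
  have hs : s ≠ 0 := (ne_zero_of_comp_eq_nsmul_id hN hsπ h0).1
  have hex : ∃ j, s ≫ biproduct.π F j ≠ 0 := by
    by_contra hall
    push Not at hall
    exact hs (biproduct.hom_ext _ _ fun j => by rw [hall j, zero_comp])
  obtain ⟨j, hj⟩ := hex
  exact ⟨j, ⟨_, isIsogeny_of_isSimple_of_ne_zero hS (hF j) _ hj⟩⟩

end Factors

/-! ## §3 Case (a): a curve factor whose field embeds in that of a threefold factor forces `D²(X) ≠ B²(X)` -/

section CaseA

variable {X : AbelianVariety ℂ}

/-- **Moonen–Zarhin's case (a) forces an exceptional class in `H⁴` of a CM fourfold.**  Let `X` be a complex abelian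
variety of CM type with `dim X = 4`, `E` an elliptic curve and `T` a simple abelian threefold which are ISOGENY FACTORS of
`X` (`E ≼ X`, `T ≼ X` — for `dim E + dim T = dim X` this is `X ∼ E × T`), with a ring embedding
`End⁰(E) ↪ End⁰(T)` (`E` has CM by `k = End⁰(E)`, `k ↪ End⁰(T)`).  Then `X` carries a rational `(2,2)`-class
OUTSIDE `D²(X) ⊗ ℂ` — a Weil class of `k`: «the Weil classes are really needed … `D²(X) ≠ B²(X)`».  Proof: regroup
`X ∼ ⨁ᵢ A'_{cls i}` (gen 36); `E`, `T` are isogenous to representatives `A'_{cls i}`, `A'_{cls j}` (uniqueness of simple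
factors), whose fields `K'_{cls i} ≅ End⁰ ≅ k` and `K'_{cls j} ≅ End⁰(T)` inherit the embedding; seat b16 gen 37's Weil
fibre puts the class on `⨁ᵢ A'_{cls i}`, and it descends to the isogenous `X` degree by degree.
[cite: MoonenZarhin1999LowDim, Thm. (0.1) (a), (1) and the remark after (4)] [cite: MumfordAV1970, §19 Cor. 1–2] -/
theorem exists_exceptional_two_of_curve_threefold_factors (hcm : IsOfCMType X) (h4 : X.dim = 4)
    {E T : AbelianVariety ℂ} (hE : E.dim = 1) (hT : T.IsSimple) (hT3 : T.dim = 3) (hEX : AVDominatedBy E X)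
    (hTX : AVDominatedBy T X) (e : E.endAlgebra →+* T.endAlgebra) :
    ∃ c : complexBetti X.X (2 * 2), IsRationalClass c ∧ IsOfHodgeType X.dim X.X (2 * 2) 2 2 c ∧
      c ∉ divisorClassesSpan X.X X.dim 2 := by
  classical
  obtain ⟨C, _, K', _, _, _, Φ', A', ι', θ', m, cls, f, hA, hs, hniso, -, hf⟩ :=
    exists_isIsogeny_biproduct_of_isSimple_of_isOfCMType (X := X) (by omega) hcm
  have hXP : AVDominatedBy X (⨁ fun i => A' (cls i)) := AVDominatedBy.of_isIsogeny_hom hf (AVDominatedBy.refl _)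
  have hPX : IsIsogenous (⨁ fun i => A' (cls i)) X := IsIsogenous.symm' ⟨f, hf⟩
  -- `E ∼ A'_{cls i}`, `T ∼ A'_{cls j}`
  obtain ⟨i, hi⟩ := exists_isIsogenous_of_isSimple_of_avDominatedBy_biproduct (F := fun i => A' (cls i))
    (fun i => hs (cls i)) (isSimple_of_dim_le_one (by omega)) (by omega) (hEX.trans hXP)
  obtain ⟨j, hj⟩ := exists_isIsogenous_of_isSimple_of_avDominatedBy_biproduct (F := fun i => A' (cls i))
    (fun i => hs (cls i)) hT (by omega) (hTX.trans hXP)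
  have h1 : (A' (cls i)).dim = 1 := by obtain ⟨g, hg⟩ := hi; rw [← dim_eq_of_isIsogeny hg, hE]
  have h3 : (A' (cls j)).dim = 3 := by obtain ⟨g, hg⟩ := hj; rw [← dim_eq_of_isIsogeny hg, hT3]
  -- the embedding `K'_{cls i} ≅ End⁰(A'_{cls i}) ≅ End⁰(E) ↪ End⁰(T) ≅ End⁰(A'_{cls j}) ≅ K'_{cls j}`
  obtain ⟨eE⟩ := nonempty_ringEquiv_endAlgebra_of_isSimple (hA (cls i)) (hs (cls i))
  obtain ⟨eT⟩ := nonempty_ringEquiv_endAlgebra_of_isSimple (hA (cls j)) (hs (cls j))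
  obtain ⟨uE⟩ := hi.nonempty_endAlgebra_algEquiv
  obtain ⟨uT⟩ := hj.nonempty_endAlgebra_algEquiv
  let e' : K' (cls i) →+* K' (cls j) :=
    eT.symm.toRingHom.comp (uT.toRingEquiv.toRingHom.comp (e.comp (uE.symm.toRingEquiv.toRingHom.comp eE.toRingHom)))
  obtain ⟨c, hcQ, hcH, hcD⟩ := exists_exceptional_two_prod_of_dim_one_dim_three_of_ringHom hA hs hniso cls h1 h3 e'
  by_contra hno
  push Not at hno
  exact hcD (mem_divisorClassesSpan_of_isIsogenous_of_forall hPX 2 (fun c hc hpp => hno c hc hpp) c hcQ hcH)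

/-- **Case (a) verbatim: `X ∼ E × T` with `E` an elliptic curve (with CM by `k = End⁰(E)`), `T` a simple abelian
threefold and `k ↪ End⁰(T)` ⟹ a rational `(2,2)`-class on `X` outside `D²(X) ⊗ ℂ`** (`E ≼ E × T ∼ X`,
`T ≼ E × T ∼ X`). [cite: MoonenZarhin1999LowDim, Thm. (0.1) (a), (1) and the remark after (4)] -/
theorem exists_exceptional_two_of_isIsogenous_curve_prod_threefold (hcm : IsOfCMType X) (h4 : X.dim = 4)
    {E T : AbelianVariety ℂ} (hE : E.dim = 1) (hT : T.IsSimple) (hT3 : T.dim = 3)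
    (hXET : IsIsogenous X (E.prod T)) (e : E.endAlgebra →+* T.endAlgebra) :
    ∃ c : complexBetti X.X (2 * 2), IsRationalClass c ∧ IsOfHodgeType X.dim X.X (2 * 2) 2 2 c ∧
      c ∉ divisorClassesSpan X.X X.dim 2 :=
  have hETX : AVDominatedBy (E.prod T) X := AVDominatedBy.of_isIsogenous hXET.symm' (AVDominatedBy.refl X)
  exists_exceptional_two_of_curve_threefold_factors hcm h4 hE hT hT3 ((SliceExhaustion.avDominatedBy_prod_left E T).trans hETX)
    ((avDominatedBy_prod_right E T).trans hETX) e

/-- **Case (a) ⟹ `X` is NOT divisor-generated** (`B•(X) ≠ D•(X)`, already in degree `2`).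
[cite: MoonenZarhin1999LowDim, Thm. (0.1) (a) and (1)] -/
theorem not_isDivisorGenerated_of_curve_threefold_factors (hcm : IsOfCMType X) (h4 : X.dim = 4)
    {E T : AbelianVariety ℂ} (hE : E.dim = 1) (hT : T.IsSimple) (hT3 : T.dim = 3) (hEX : AVDominatedBy E X)
    (hTX : AVDominatedBy T X) (e : E.endAlgebra →+* T.endAlgebra) : ¬ IsDivisorGenerated X := fun hD => by
  obtain ⟨c, hcQ, hcH, hcD⟩ := exists_exceptional_two_of_curve_threefold_factors hcm h4 hE hT hT3 hEX hTX e
  exact hcD (hD 2 c hcQ hcH)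

/-- **A SIMPLE fourfold has no elliptic-curve isogeny factor** (a non-zero homomorphism between simple abelian
varieties is an isogeny and preserves the dimension): case (a) never meets a simple `X`.
[cite: MumfordAV1970, §19 Cor. 2 of Thm. 1] -/
theorem not_avDominatedBy_of_isSimple_of_dim_lt {E : AbelianVariety ℂ} (hXs : X.IsSimple) (hE : E.IsSimple)
    (h0 : 0 < E.dim) (hlt : E.dim < X.dim) : ¬ AVDominatedBy E X := fun h => by
  obtain ⟨g, hg⟩ := isIsogenous_of_isSimple_of_avDominatedBy hE hXs h0 h
  have := dim_eq_of_isIsogeny hg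
  omega

end CaseA

/-! ## §4 A divisor-generated CM fourfold is stably divisor-generated -/

section Powers

variable {X : AbelianVariety ℂ}

/-- **MASTER FORM — a divisor-generated complex abelian fourfold of CM type is STABLY divisor-generated**
(Moonen–Zarhin (0.1) (4) with (1), CM case; Gordon 7.5 (3) ⟹ (1) with 7.6.1): if `X` is of CM type, `dim X = 4` and
`B•(X) = D•(X)`, then every complex abelian variety `B` DOMINATED by a power `X^{N+1}` (every power, everything
isogenous to a power, every abelian subvariety and every quotient of a power, every product of such) is
divisor-generated.  Proof: regroup `X ∼ ⨁ᵢ A'_{cls i}` with simple, pairwise non-isogenous CM representatives of total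
dimension `≤ 4` (gen 36); `B = D` on `X` excludes an embedded curve field in a sextic slot (else seat b16 gen 37's Weil
fibre gives an exceptional class on `⨁ᵢ A'_{cls i} ≼ X`) and forces an octic slot to be nondegenerate
(`A'_b ≼ X` is divisor-generated; lit-deligne-3's octic criterion); so the family is NONDEGENERATE (file 1), `B = D` on
every `⨁_j A'_{π j}`, and `B ≼ X^{N+1} ≼ ⨁_j A'_{π j}` inherits it. UNCONDITIONAL. [cite: MoonenZarhin1999LowDim, Thm. (0.1) (1) and (4)]
[cite: Gordon1999HodgeAVSurvey, 7.5 and 7.6.1] [cite: Milne1999LefschetzClasses, §1 Prop. 1.1] -/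
theorem isDivisorGenerated_of_avDominatedBy_powSucc_of_isOfCMType_of_dim_four {B : AbelianVariety ℂ}
    (hcm : IsOfCMType X) (h4 : X.dim = 4) (hX : IsDivisorGenerated X) {N : ℕ} (hB : AVDominatedBy B (X.powSucc N)) :
    IsDivisorGenerated B := by
  classical
  obtain ⟨C, _, K', _, _, _, Φ', A', ι', θ', m, cls, f, hA, hs, hniso, hcls, hf⟩ :=
    exists_isIsogeny_biproduct_of_isSimple_of_isOfCMType (X := X) (by omega) hcm
  haveI : Nonempty C := ⟨cls 0⟩
  have hsum : ∑ c, (A' c).dim ≤ 4 := (sum_dim_le_dim_of_isIsogeny_biproduct hcls hf).trans h4.le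
  have hXP : AVDominatedBy X (⨁ fun i => A' (cls i)) := AVDominatedBy.of_isIsogeny_hom hf (AVDominatedBy.refl _)
  have hPX : AVDominatedBy (⨁ fun i => A' (cls i)) X := AVDominatedBy.of_isIsogeny_inv hf (AVDominatedBy.refl _)
  have hP : IsDivisorGenerated (⨁ fun i => A' (cls i)) := isDivisorGenerated_of_avDominatedBy hPX hX
  -- (¬a) on the representatives: an embedded curve field would put an exceptional class on `⨁ᵢ A'_{cls i} ≼ X`
  have hfor : ∀ a b, a ≠ b → (A' a).dim = 1 → (A' b).dim = 3 → IsEmpty (K' a →+* K' b) := by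
    intro a b _ ha hb
    by_contra hne
    rw [not_isEmpty_iff] at hne
    obtain ⟨e⟩ := hne
    obtain ⟨ia, rfl⟩ := hcls a
    obtain ⟨ib, rfl⟩ := hcls b
    obtain ⟨c, hcQ, hcH, hcD⟩ := exists_exceptional_two_prod_of_dim_one_dim_three_of_ringHom hA hs hniso cls ha hb e
    exact hcD (hP 2 c hcQ hcH)
  -- (¬b) on the representatives: an octic slot `A'_b ≼ X` is divisor-generated, hence its type is nondegenerate
  have hoct : ∀ b, (A' b).dim = 4 → IsNondegenerate (Φ' b) := by
    intro b hb
    obtain ⟨ib, rfl⟩ := hcls b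
    obtain ⟨φ₀⟩ : Nonempty (K' (cls ib) →+* ℂ) := inferInstance
    have h8 : Module.finrank ℚ (K' (cls ib)) = 8 := by
      rw [finrank_eq_two_mul_dim_of_isCMTypeRealisation (hA (cls ib)), hb]
    have hDb : IsDivisorGenerated (A' (cls ib)) :=
      isDivisorGenerated_of_avDominatedBy ((avDominatedBy_biproduct_summand (fun i => A' (cls i)) ib).trans hPX) hX
    exact (isDivisorGenerated_iff_isNondegenerate_of_finrank_eq_eight h8 φ₀
      ((isSimple_iff_isPrimitive (hA (cls ib)) φ₀).1 (hs (cls ib))) (hA (cls ib))).1 hDb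
  obtain ⟨n, π, hdom⟩ := exists_avDominatedBy_powSucc_biproduct_slots A' cls hXP N
  refine isDivisorGenerated_of_avDominatedBy (hB.trans hdom) fun p c hcQ hcH => ?_
  rw [← hodgeClassSpan_prod_eq_divisorClassesSpan_of_sum_dim_le_four hA hs hniso hsum hfor hoct π p]
  exact Submodule.subset_span ⟨hcQ, hcH⟩

/-- **`B•(X) = D•(X) ⟺ B•(X^{N+1}) = D•(X^{N+1})` for all `N`, for every complex abelian FOURFOLD of CM type**:
exceptional Hodge classes of a CM fourfold, if any, already live on `X` (Moonen–Zarhin (0.1): in cases (a), (b)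
`D²(X) ≠ B²(X)`; otherwise all powers are divisor-generated). [cite: MoonenZarhin1999LowDim, Thm. (0.1) (1), (4)]
[cite: Gordon1999HodgeAVSurvey, 7.5] -/
theorem isDivisorGenerated_iff_forall_powSucc_of_isOfCMType_of_dim_four (hcm : IsOfCMType X) (h4 : X.dim = 4) :
    IsDivisorGenerated X ↔ ∀ N : ℕ, IsDivisorGenerated (X.powSucc N) :=
  ⟨fun hX _ => isDivisorGenerated_of_avDominatedBy_powSucc_of_isOfCMType_of_dim_four hcm h4 hX (AVDominatedBy.refl _),
    fun h => h 0⟩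

/-- **The Hodge conjecture for everything dominated by a power of a divisor-generated CM fourfold**, UNCONDITIONALLY
(`B = D` + Lefschetz `(1,1)` + products of divisors algebraic). [cite: MoonenZarhin1999LowDim, Thm. (0.1) (4)]
[cite: Gordon1999HodgeAVSurvey, 10.10] [cite: Deligne2000, §1] -/
theorem hodgeConjectureFor_of_avDominatedBy_powSucc_of_isDivisorGenerated_of_dim_four {B : AbelianVariety ℂ} {N : ℕ}
    (hcm : IsOfCMType X) (h4 : X.dim = 4) (hX : IsDivisorGenerated X) (hB : AVDominatedBy B (X.powSucc N)) :
    HodgeConjectureFor B.dim B.X :=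
  hodgeConjectureFor_of_isDivisorGenerated _
    (isDivisorGenerated_of_avDominatedBy_powSucc_of_isOfCMType_of_dim_four hcm h4 hX hB)

/-- **The Hodge conjecture for every power `X^{N+1}` of a divisor-generated CM fourfold** (dimension `4(N+1)`),
UNCONDITIONALLY. [cite: MoonenZarhin1999LowDim, Thm. (0.1) (4)] [cite: Gordon1999HodgeAVSurvey, 10.10] -/
theorem hodgeConjectureFor_powSucc_of_isDivisorGenerated_of_dim_four (hcm : IsOfCMType X) (h4 : X.dim = 4)
    (hX : IsDivisorGenerated X) (N : ℕ) : HodgeConjectureFor (X.powSucc N).dim (X.powSucc N).X :=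
  hodgeConjectureFor_of_avDominatedBy_powSucc_of_isDivisorGenerated_of_dim_four hcm h4 hX (AVDominatedBy.refl _)

/-- **The Hodge conjecture for everything isogenous to a power** of a divisor-generated CM fourfold.
[cite: MoonenZarhin1999LowDim, Thm. (0.1) (4)] [cite: vanGeemen1994HodgeAV, Lemma 3.7] -/
theorem hodgeConjectureFor_of_isIsogenous_powSucc_of_isDivisorGenerated_of_dim_four {B : AbelianVariety ℂ} {N : ℕ}
    (hcm : IsOfCMType X) (h4 : X.dim = 4) (hX : IsDivisorGenerated X) (h : IsIsogenous B (X.powSucc N)) :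
    HodgeConjectureFor B.dim B.X :=
  hodgeConjectureFor_of_avDominatedBy_powSucc_of_isDivisorGenerated_of_dim_four hcm h4 hX
    (AVDominatedBy.of_isIsogenous h (AVDominatedBy.refl _))

/-- **Class-target display** (`Ring2.ClassTargets.HCOnClass`): the Hodge conjecture on the class of complex abelian
varieties dominated by a power of a divisor-generated CM abelian fourfold. UNCONDITIONAL.
[cite: MoonenZarhin1999LowDim, Thm. (0.1) (4)] [cite: Deligne2000, §1] -/
theorem hcOnClass_avDominatedBy_powSucc_isOfCMType_dim_four_isDivisorGenerated :
    HCOnClass fun B => ∃ (X : AbelianVariety ℂ) (N : ℕ),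
      IsOfCMType X ∧ X.dim = 4 ∧ IsDivisorGenerated X ∧ AVDominatedBy B (X.powSucc N) :=
  fun _ ⟨_, _, hcm, h4, hX, hB⟩ => hodgeConjectureFor_of_avDominatedBy_powSucc_of_isDivisorGenerated_of_dim_four hcm h4 hX hB

end Powers

end Summit.HodgeConjecture.CorCM

end
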